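import Summits.BirchSwinnertonDyer.Rank1Residual.X12.CMRamifiedAdditive
import Literature.NumberTheory.EllipticCurves.AnomalousOfRationalTorsionProofs
import Literature.NumberTheory.EllipticCurves.VariableChangePoints
import HarnessLib

/-!
# No rational `p`-torsion anywhere in the `ℚ`-isogeny class, I: a one-prime point-count
# certificate, and the irreducible case

HONEST FRAMING (cell `b2b-bsdres`, run/shared/lean/b2b/bsd-rank1-residual/, verbatim in every
file): the goal of the cell is to DELETE the COMBINATION-SHAPED residual classes of the
Birch–Swinnerton-Dyer formula for ALL analytic-rank `≤ 1` elliptic curves over `ℚ` — "full BSD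
formula for every rank `≤ 1` curve in class `C`" assembled STRICTLY from published theorems — so
that the rank-`≤ 1` remainder becomes exactly the CONSTRUCTION-SHAPED classes, which are TYPED
(missing-input `Prop`s), NOT attempted. This is not "finishing BSD". Harvest seat 1 (census /
instrument seat for class X12; prover owner x1b since 2026-08-20T04:23Z), generation 17. Theorems
only (compositions of tree theorems BY NAME); no definition, no named fact; nothing booked; no label
and no census number moves; X12 REMAINS CONSTRUCTION-SHAPED.

## Why

The per-pair lever T-LW of the certificate lane — Lawson–Wuthrich 2016 Thm. 14 (tree facts
`LawsonWuthrich2016.thm14_padicValNat_shaOrder_le[_odd|_general]`; Kolyvagin's Heegner-index bound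
WITHOUT an image hypothesis) — carries the binder

  `htors : ∀ W' ℚ-isogenous to W, ∀ Q ∈ W'(ℚ), p • Q = 0 → Q = 0`

("no curve `ℚ`-isogenous to `E` has a rational point of order `p`", the table-checkable form of the
printed clause "`E` is not isogenous to a curve whose dual isogeny contains a rational `p`-torsion
point" and of Theorem 1's item at `p = 3`). It is the ONLY per-pair lever for the fifteen class-X12
pairs with `p` RAMIFIED in the CM field (`E[p]` reducible: `X12/CMRamifiedReducible.lean`), and a
second lever (besides Matar–Nekovář) on the 72-pair inert-bad core (X12 owner memo
`HOME/b2b-bsdres-x1b/X12-ROUTE.md` §1). This file and its sequel `X12/CMNoPrimeTorsion.lean`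
discharge `htors`:

* §1 `eq_zero_of_nsmul_eq_zero_of_not_dvd_reductionPointCount` — ONE good odd prime `ℓ` with
  `p ∤ #Ẽ(𝔽_ℓ)` kills the rational `p`-torsion of `W` (Silverman *AEC* VII.3.1(b): the order of a
  rational torsion point divides `#Ẽ(𝔽_ℓ)`, tree `addOrderOf_dvd_reductionPointCount`), and
  `noPTorsion_isogenyClass_of_not_dvd_reductionPointCount` — the same certificate kills it on EVERY
  curve `ℚ`-isogenous to `W` (a globally minimal model of `W'`, `hasGlobalMinimalModel_rat_holds`
  + `VariableChange.pointEquiv`; good reduction and `a_ℓ` are isogeny invariants, *AEC* VII.7.2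
  `IsIsogenous.hasGoodReductionAtPrime_iff` and Faltings 1983 §5 Kor. 2
  `frobeniusTrace_eq_of_isIsogenous`). A kernel-decidable certificate for ANY class (X1 leaf
  included): one point count at one small prime.
* §2 `noPTorsion_isogenyClass_of_irr` — `E[p]` irreducible ⟹ `htors` (irreducibility is an isogeny
  invariant, `not_hasIrreducibleModPGaloisRep_of_isIsogenous`; an irreducible `E'[p]` has no rational
  line, `not_exists_addOrderOf_eq_of_hasIrreducibleModPGaloisRep`).

The sequel proves the THEOREM "CM ∧ (`p` odd unramified in the CM field ∨ `p ≥ 5`) ⟹ `htors`".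

References: Silverman *AEC* VII.3.1(b), VII.7.2, VIII.8.3; Faltings 1983 §5 Kor. 2; Mazur 1977
Ch. III §5; Lawson–Wuthrich 2016 Thm. 1, Thm. 14.
-/

noncomputable section

open scoped Classical NumberTheorySymbols

open WeierstrassCurve Literature.NumberTheory.EllipticCurves
  Literature.NumberTheory.EllipticCurves.Rank1Residual

namespace Summit.BirchSwinnertonDyer.Rank1Residual.X12

/-! ## §1 The one-prime point-count certificate -/

/-- **`p ∤ #Ẽ(𝔽_ℓ)` at a good odd prime `ℓ` kills the rational `p`-torsion.** For `W/ℚ` globally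
minimal elliptic, `ℓ ≥ 3` a prime of good reduction with `p ∤ #Ẽ(𝔽_ℓ)` (`reductionPointCount`), and
`Q ∈ E(ℚ)` with `p • Q = O`: `Q = O` — the order of `Q` divides `p` and `#Ẽ(𝔽_ℓ)` (Silverman *AEC*
VII.3.1(b), tree `addOrderOf_dvd_reductionPointCount`), hence is `1`.
[cite: SilvermanAEC2009, VII.3.1(b)] -/
theorem eq_zero_of_nsmul_eq_zero_of_not_dvd_reductionPointCount (W : WeierstrassCurve ℚ)
    [W.IsElliptic] [W.IsGloballyMinimal] {p : ℕ} [hp : Fact p.Prime] {ℓ : ℕ} [Fact ℓ.Prime]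
    (hℓ3 : 3 ≤ ℓ) (hgood : W.HasGoodReductionAtPrime ℓ) (hN : ¬ p ∣ W.reductionPointCount ℓ)
    (Q : W.toAffine.Point) (hQ : p • Q = 0) : Q = 0 := by
  have hfin : IsOfFinAddOrder Q := isOfFinAddOrder_iff_nsmul_eq_zero.mpr ⟨p, hp.out.pos, hQ⟩
  have hΔ : ¬ (ℓ : ℤ) ∣ minimalDiscriminantInt W :=
    not_dvd_minimalDiscriminantInt_of_hasGoodReductionAtPrime' W ℓ hgood
  have hdvdN : addOrderOf Q ∣ W.reductionPointCount ℓ :=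
    addOrderOf_dvd_reductionPointCount W ℓ hℓ3 hΔ hfin
  have hdvdp : addOrderOf Q ∣ p := addOrderOf_dvd_of_nsmul_eq_zero hQ
  rcases (Nat.dvd_prime hp.out).mp hdvdp with h1 | hpQ
  · exact AddMonoid.addOrderOf_eq_one_iff.mp h1
  · exact absurd (hpQ ▸ hdvdN) hN

/-- Bookkeeping: `ℚ`-isogenous globally minimal curves have the same `#Ẽ(𝔽_ℓ)` at a common good
prime `ℓ` (`a_ℓ = ℓ + 1 − #Ẽ(𝔽_ℓ)` is an isogeny invariant: Faltings 1983 §5 Kor. 2, tree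
`frobeniusTrace_eq_of_isIsogenous`; classically *AEC* Ex. 5.4(a)).
[cite: Faltings1983Endlichkeit, §5 Korollar 2, (i) ⇒ (iv)] [cite: SilvermanAEC2009, Cor. VII.7.2] -/
theorem reductionPointCount_eq_of_isIsogenous {W W' : WeierstrassCurve ℚ} [W.IsElliptic]
    [W.IsGloballyMinimal] [W'.IsElliptic] [W'.IsGloballyMinimal] (h : IsIsogenous W W') (ℓ : ℕ)
    [Fact ℓ.Prime] (hgood : W.HasGoodReductionAtPrime ℓ) :
    W.reductionPointCount ℓ = W'.reductionPointCount ℓ := by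
  have hgood' : W'.HasGoodReductionAtPrime ℓ := (h.hasGoodReductionAtPrime_iff ℓ).mp hgood
  have htr := frobeniusTrace_eq_of_isIsogenous h ℓ hgood hgood'
  simp only [WeierstrassCurve.frobeniusTrace] at htr
  omega

/-- **The one-prime certificate kills the rational `p`-torsion of EVERY `ℚ`-isogenous curve.** For
`W/ℚ` globally minimal elliptic and a good odd prime `ℓ` with `p ∤ #Ẽ(𝔽_ℓ)`: no curve `W'`
`ℚ`-isogenous to `W` (any model) has a rational point `Q ≠ O` with `p • Q = O`. Proof: a globally
minimal model `C • W'` (*AEC* VIII.8.3, `hasGlobalMinimalModel_rat_holds`) is isogenous to `W`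
(`IsIsogenous.smul_right`), good at `ℓ` (*AEC* VII.7.2) with the same `#Ẽ(𝔽_ℓ)`
(`reductionPointCount_eq_of_isIsogenous`); transport `Q` along `VariableChange.pointEquiv` and apply
§1. This is exactly the `htors` binder of `LawsonWuthrich2016.thm14_padicValNat_shaOrder_le*`.
[cite: SilvermanAEC2009, VII.3.1(b), Cor. VII.7.2 and VIII.8 Cor. 8.3] [cite: Faltings1983Endlichkeit, §5 Korollar 2, (i) ⇒ (iv)] -/
theorem noPTorsion_isogenyClass_of_not_dvd_reductionPointCount (W : WeierstrassCurve ℚ)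
    [W.IsElliptic] [W.IsGloballyMinimal] {p : ℕ} [Fact p.Prime] {ℓ : ℕ} [Fact ℓ.Prime]
    (hℓ3 : 3 ≤ ℓ) (hgood : W.HasGoodReductionAtPrime ℓ) (hN : ¬ p ∣ W.reductionPointCount ℓ) :
    ∀ (W' : WeierstrassCurve ℚ) [W'.IsElliptic], IsIsogenous W W' →
      ∀ Q : W'.toAffine.Point, p • Q = 0 → Q = 0 := by
  intro W' _ hiso Q hQ
  obtain ⟨C, hC⟩ := hasGlobalMinimalModel_rat_holds W'
  haveI := hC
  have hiso' : IsIsogenous W (C • W') := hiso.smul_right C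
  have hgood' : (C • W').HasGoodReductionAtPrime ℓ := (hiso'.hasGoodReductionAtPrime_iff ℓ).mp hgood
  have hN' : ¬ p ∣ (C • W').reductionPointCount ℓ := by
    rwa [← reductionPointCount_eq_of_isIsogenous hiso' ℓ hgood]
  set Q' : (C • W').toAffine.Point := VariableChange.pointEquiv W' C Q with hQ'def
  have hQ' : p • Q' = 0 := by rw [hQ'def, ← map_nsmul, hQ, map_zero]
  have h0 : Q' = 0 :=
    eq_zero_of_nsmul_eq_zero_of_not_dvd_reductionPointCount (C • W') hℓ3 hgood' hN' Q' hQ'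
  have : VariableChange.pointEquiv W' C Q = VariableChange.pointEquiv W' C 0 := by
    rw [map_zero]; exact h0
  exact (VariableChange.pointEquiv W' C).injective this

/-- The certificate in `a_ℓ`-currency: `p ∤ ℓ + 1 − a_ℓ` at a good odd prime `ℓ` ⟹ `htors`.
[cite: SilvermanAEC2009, VII.3.1(b) and Cor. VII.7.2] -/
theorem noPTorsion_isogenyClass_of_not_dvd_frobenius (W : WeierstrassCurve ℚ)
    [W.IsElliptic] [W.IsGloballyMinimal] {p : ℕ} [Fact p.Prime] {ℓ : ℕ} [Fact ℓ.Prime]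
    (hℓ3 : 3 ≤ ℓ) (hgood : W.HasGoodReductionAtPrime ℓ)
    (hN : ¬ (p : ℤ) ∣ (ℓ : ℤ) + 1 - W.frobeniusTrace ℓ) :
    ∀ (W' : WeierstrassCurve ℚ) [W'.IsElliptic], IsIsogenous W W' →
      ∀ Q : W'.toAffine.Point, p • Q = 0 → Q = 0 := by
  refine noPTorsion_isogenyClass_of_not_dvd_reductionPointCount W hℓ3 hgood fun h ↦ hN ?_
  have : (ℓ : ℤ) + 1 - W.frobeniusTrace ℓ = W.reductionPointCount ℓ := by
    simp only [WeierstrassCurve.frobeniusTrace]; ring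
  rw [this]
  exact Int.natCast_dvd_natCast.mpr h

/-! ## §2 Irreducible `E[p]` ⟹ no rational `p`-torsion in the isogeny class -/

/-- **`E[p]` irreducible ⟹ no curve `ℚ`-isogenous to `E` has a rational point of order `p`.**
Irreducibility of `E[p]` is a `ℚ`-isogeny invariant (tree
`not_hasIrreducibleModPGaloisRep_of_isIsogenous`, with `IsIsogenous.symm_of_charZero`), and a
rational point of order `p` spans a `Γ_ℚ`-stable line (Mazur 1977 p. 157; tree
`not_exists_addOrderOf_eq_of_hasIrreducibleModPGaloisRep`). [cite: Mazur1977, Ch. III §5, p. 157] -/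
theorem noPTorsion_isogenyClass_of_irr (W : WeierstrassCurve ℚ) [W.IsElliptic] {p : ℕ}
    [hp : Fact p.Prime] (hirr : W.HasIrreducibleModPGaloisRep p) :
    ∀ (W' : WeierstrassCurve ℚ) [W'.IsElliptic], IsIsogenous W W' →
      ∀ Q : W'.toAffine.Point, p • Q = 0 → Q = 0 := by
  intro W' _ hiso Q hQ
  have hirr' : W'.HasIrreducibleModPGaloisRep p := by
    by_contra hred'
    exact not_hasIrreducibleModPGaloisRep_of_isIsogenous (p := p) hiso.symm_of_charZero hred' hirr
  by_contra hne
  have hdvdp : addOrderOf Q ∣ p := addOrderOf_dvd_of_nsmul_eq_zero hQ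
  have hord : addOrderOf Q = p := by
    rcases (Nat.dvd_prime hp.out).mp hdvdp with h1 | hpQ
    · exact absurd (AddMonoid.addOrderOf_eq_one_iff.mp h1) hne
    · exact hpQ
  exact not_exists_addOrderOf_eq_of_hasIrreducibleModPGaloisRep W' hirr'
    ⟨Q, (Rank1Residual.addOrderOf_point_eq_of_subsingleton W' _ _ _).trans hord⟩

end Summit.BirchSwinnertonDyer.Rank1Residual.X12

end
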